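import Literature.MathematicalPhysics.QuantumFieldTheory.Balaban1983to89.B9Eq3124HZKnitPairReg335Y
import Literature.MathematicalPhysics.QuantumFieldTheory.Balaban1983to89.B9Eq358KeyEstimate
import Literature.MathematicalPhysics.QuantumFieldTheory.Balaban1983to89.B9Eq380QknitVariationY
import Literature.MathematicalPhysics.QuantumFieldTheory.Balaban1983to89.B9SectBCodedClassKnitY

/-!
# `Balaban1983to89.B9Eq358KnitTransporterVariationY` — T. Bałaban, *Propagators for lattice gauge theories in a background field*, Commun. Math. Phys. **99**
# (1985) 389–434 [Balaban1985BackgroundPropagators] (3.55)–(3.58) pp. 401–402, (3.35)–(3.37) p. 396: ★★★ **(3.58) FOR THE KNIT SITE TRANSPORTER `parKnitY` ON THE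
# CLASS (3.35) × (3.37)** — `‖U′U(Γ^{(j)}_{y,w}) − U(Γ^{(j)}_{y,w})‖ ≤ 154(d+1)·α₁` for def-Y's knit transporter from the corner of `w`'s block (`j` its level, `y` its
# label), every member background `U` of `(bg9KP M_N(ℂ) G i).Reg335 c₀ α₀` (`G ≤ U(N)`), every perturbation `U′ = e^{iηa}` with `a` in r06's NESTED class (3.37)
# `Cplx337 … (levV1 i) α₁ a`, under x-free numerics — p06's key estimate `B9Eq358KeyEstimate.norm_pFac_sub_one_le_linear` (all `j`, general (52)-regular base,
# complex multiplier) at the RETRACTION of the lift to the block (this lineage's `pdev_retract_block_lt ∕ compT_bgT_congr`), through ONE bridge lemma identifying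
# J-B's top-down composite `compT L (bgT L V)` with p06's bottom-up tower gauge composite `B9Eq358Decomposition.compT`

statement-level skeleton of published theorems with citation tags; proofs where landed; nothing here is a claim about the Yang–Mills mass gap

PDFs held: `paper:balaban1985-cmp99-background-propagators` (pp. 396, 401–402, 406 read this seat from the text layer and through p06's verbatim quotations).

CITATION HEADER (lean-in-tree rule).  Cell `pub-ymgap` (YM Track A, D-0062), node N06, seat `pub-ymgap-dag-n06-l` (gen 39; bundle F7 rows 20–21; K1⁹ `stmt-QuantumFields-27364`
SUPPORTS lane) — node00-def-Y's SCOPING 2026-08-30 21:36Z item **(K1)** «`norm_parKnitY_cplxMul_sub_le` — SUPPLIER WANTED, first refusal n06-l» (taken I.20631), stated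
in dag-n06-c g26's displayed law shape `B9SectBCodedClassKnitY.ParVar337Y G i (parKnitY i) R Cp αK aK` (their INTENT-1, 21:45Z; `R := (bg9KP … G i).Reg335 c₀`,
corner pairs, raw `Cplx337` multiplier) so that the law is inhabited by `fun … => norm_parKnitY_mulY_sub_le …` — the (3.58) input of KC's `hC37` at `parA := parKnitY`.
REUSED BY NAME, nothing restated: p06 `B9Eq358KeyEstimate.norm_pFac_sub_one_le_linear` ((3.58)'s key estimate, general background), `B9Eq358Decomposition.compT ∕ pFac ∕
compT_mem`, `B9Eq357Levels.compT_succ_top`; r04∕p06 `B7Eq162General.level_facts`; J-B `B9B8AveragingJunction.parKnitY ∕ parOfT_blkCornerY ∕ blockMap_iterate ∕ blk_eq_blockMap ∕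
mem_XB_of_blk_eq ∕ boxEquiv_transl_of_mem`, `B9B8AveragingKernelZd.compT ∕ compT_zero ∕ compT_succ`, `B8Eq119TwistedAxial.bgT`, `B8Eq115GaugeFixing.axialFn_self`; this lineage's
`B9Eq3124HZKnitPairReg335Y.pdev_retract_block_lt ∕ compT_bgT_congr ∕ blk_eq_of_inBox_block`, `B9Eq380QknitVariationY.liftCfg_mulY_fluct`; b07 `B7Eq52RetractionExtension.retrCfg`,
`B7Prop5Flat.insCfg ∕ restr ∕ agreeOn_insCfg_restr ∕ agreeOn_expCfg ∕ bondsIn`, `B7Prop2Explicit.avgIter_mem ∕ avgClosed_unitaryUnits`; r06 `B9Eq335RegularityClasses.Cplx337`;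
def-Y `B9Eq360DeltaPrimeAY.mulY`.

THE PRINT.  p. 401: *«(U′U)(Γ^{(j)}_{y,x}) = \overline{(U′U)}^{j−1}(Γ_{y,x_{j−1}})·…·(U′U)(Γ_{x₁,x}) … (3.55) … By Proposition 4 [5] the expression on the right-hand side of
(3.57) is an analytic function of A, and by the above bounds |(U′U)(Γ^{(j)}_{y,x})(U(Γ^{(j)}_{y,x}))⁻¹ − 1| < O(1)α₁.»*  p. 402: *«|F′_{2,j}(A; y, x)| ≦ O(1)α₁ (3.58)»*.
p. 396 (3.37): *«|A′| < α₁(Lʲη)⁻¹ … on Ω_j»*; (3.35): the small-field class of the base.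

THE ROAD.  (i) BRIDGE `compT_bgT_eq_compT358`: J-B's `compT L (bgT L V) j (⌊x∕L⌋^{[j]}) x` (legs peeled from the top, each the axial transporter of `V̄ⁿ` from the base of the
`L`-block of the level-`(n+1)` ancestor) IS p06's `compT L V j (⌊x∕L⌋^{[j]}) x` (the tower gauge function `tg`, whose top-peeled recursion is `compT_succ_top`) — induction on `j`
(`fl = blockMap` and `blockBase L y = L·y` definitionally∕pointwise); (ii) `parKnitY V (corner s) w = compT L (bgT L V♯) j y w` (`parOfT_blkCornerY`), and the composite reads
`V♯` on the block box only (`compT_bgT_congr`) — replace `U♯` by its retraction `Û_s` (`U(N)`-valued, `α₀′L^{−2j}`-regular on (3.35): `pdev_retract_block_lt`) and `(e^{iηa}U)♯ =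
e^{a♯}U♯` (`liftCfg_mulY_fluct`) by `e^{a♭}Û_s`, `a♭` the restriction of `a♯` to the box bonds; (iii) every fine site of the block has level EXACTLY `j`, so the nested class gives
`‖a‖ < α₁(Lʲη)⁻¹` there: `sup‖a♭‖ ≤ α₁L^{−j}` (`norm_blockExponentKnit_le`); (iv) p06's key estimate at `(Û_s, e^{a♭})`: `‖P − 1‖ ≤ 154(d+1)·Lʲ·(α₁L^{−j})`, and `U′U(Γ) − U(Γ) =
(P − 1)·U(Γ)` with `U(Γ)` unit-bounded ([5] Prop. 2 on the retraction, `compT_mem`).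

WHAT IS PROVED (sorry-free; 0 `def`).
* §1 ★ `compT_bgT_eq_compT358` (the bridge), `norm_units_sub_le_of_pFac` (`‖c′ − c‖ ≤ ‖c′c⁻¹ − 1‖·‖c‖`).
* §2 `lev_eq_of_mem_blockBox` (a box point of the block `s` lifts a torus site of level `j_s`), `norm_blockExponentKnit_le` (step (iii)).
* §3 ★★ `norm_knitT_retract_mulY_sub_le` (the block-level estimate at the retraction), ★★★ `norm_parKnitY_mulY_sub_le` — **(3.58) AT THE KNIT TRANSPORTER ON (3.35) × (3.37),
  CORNER PAIRS**, in dag-n06-c's `ParVar337Y` shape: `∀ α₀ U, 0 < α₀ → M·α₀ ≤ aK → (bg9KP … G i).Reg335 c₀ α₀ U → GVal G i U → ∀ α₁ a, 0 < α₁ → α₁ ≤ αK → Cplx337 … α₁ a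
  → ∀ s w, blkOf w = s → ‖parKnitY (e^{iηa}U) (corner s) w − parKnitY U (corner s) w‖ ≤ 154(d+1)·α₁`, under the x-free numerics `0 < α₀′`, `C₀α₀′ ≤ 1∕3`, `4α₀′ ≤ c₂′`,
  `hKpl : a ≤ aK ⇒ K_pl(a)·L⁴ < α₀′` (KC's shape), and the window in `αK`: `e^{4·800(d+2)²(d+5)α₀′}(1 + 8·131072(d+2)²·αK) ≤ 2`, `2αK ≤ c₃(d+1, L)`, `4096(d+1)·αK ≤ 1`;
  ★★★ `parVar337Y_parKnitY` — dag-n06-c's displayed law `ParVar337Y G i (parKnitY i) ((bg9KP …).Reg335 c₀) (154(d+1)) αK aK` INHABITED (the (K1) input of `hclass_C37KY_on`).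
HONEST SCOPE ∕ DECLARED READINGS.  A composition BY NAME: the analysis ((3.57)'s telescope, [5] (161)–(164) at a general background) is p06∕r04's, LANDED; the member-level
plumbing (retraction, block geometry, lifts) is this lineage's landed road; new here are the bridge lemma and the bookkeeping.  Crude constant `154(d+1)` for print's `O(1)`
(p06's linearised witness).  CORNER PAIRS only (the pairs the knit letters read; reverse pairs follow by `parKnitY_inv` with the inverse's Lipschitz bound — not typed here).
Count-neutral; N06 NOT discharged; K1⁹ NOT closed; nothing continuum ∕ ℝ⁴ ∕ OS ∕ mass gap ∕ Clay — the Yang–Mills mass gap is NOT proved here.  NEW file; nothing landed is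
modified.  No `sorry`, no `axiom`, no `def`, no `instance`, no `notation`.  Net new unproved facts: 0.
-/

noncomputable section

namespace Literature.MathematicalPhysics.QuantumFieldTheory.Balaban1983to89.B9Eq358KnitTransporterVariationY

open scoped BigOperators
open NormedSpace
open B7Prop1Explicit renaming Site → LSite
open B7Prop1Explicit (U1 axialFn)
open B7Prop1Local (InBox AgreeOn)
open Literature.MathematicalPhysics.QuantumLattice (blockBase blockMap)
open B7Prop5Flat (bondsIn mem_bondsIn restr agreeOn_insCfg_restr agreeOn_expCfg)
open B7Prop3Flat (insCfg expCfg c3)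
open B7Prop2Explicit (pdev avgIter avgIter_mem AvgClosed avgClosed_unitaryUnits unitaryUnits unitaryUnits_le_U1 C0 c2')
open B7Eq52RetractionExtension (retrCfg retrCfg_eq_of_bondIn retrCfg_mem)
open B8Eq119TwistedAxial (bgT)
open B8Ineq130 (fl)
open B8Eq115GaugeFixing (axialFn_self)
open B10Eq27TorusAxialLog (transl)
open B4Reflection242 (blk)
open B6Geom246MultiLevelBox (bset blkOf blkOf_eq_iff_blk lev_eq_of_blkOf_eq)
open B6GlobalChartV1 (PV boxEquiv boxEquiv_apply toBox)
open B6KLevelCensusIndexV1 (KIdx kGeo)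
open B9B8CarrierDictionary (liftCfg liftCfg_mem)
open B9B8AveragingJunction (parKnitY parOfT_blkCornerY blockMap_iterate blk_eq_blockMap mem_XB_of_blk_eq boxEquiv_transl_of_mem)
open B9Eq3124HZKnitPairReg335Y (pdev_retract_block_lt compT_bgT_congr blk_eq_of_inBox_block)
open B9Eq358Decomposition (pFac compT_mem)
open B9Eq357Levels (compT_succ_top)
open B9Eq358KeyEstimate (norm_pFac_sub_one_le_linear)
open B9Eq380QknitVariationY (liftCfg_mulY_fluct)
open B9C2FormBoxRegimeY (Kpl)
open B9BackgroundsKLevelV1 (levV1 shiftsV1)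
open B9BackgroundsKLevelV1P (bg9KP mem_of_reg335P)
open B9Eq335RegularityClasses (Cplx337 OnOmega)
open LatticeNorms (scaleLen)
open B9GeoLemma21KLevelV1 (geo9K_eta_pos)
open B9Eq39Adjoint (fluct)
open B9Eq360DeltaPrimeAY (mulY AfldY blkY)
open B9SectBGpLettersY (GVal)
open B9SectBCodedClassKnitY (ParVar337Y)
open Node00

variable {d ℓ : ℕ} {hd : 1 ≤ d + 1} {hL : Odd (ℓ + 1) ∧ 1 < ℓ + 1} {b₀ b₁ : ℝ}

/-! ## §1 The bridge: J-B's top-down composite of block transporters IS p06's tower-gauge composite -/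

section Bridge

variable {𝔸 : Type} [NormedRing 𝔸] [NormedAlgebra ℂ 𝔸] [CompleteSpace 𝔸]

/-- ★ **THE BRIDGE**: for every level-transporter tower of a background `V` on `ℤ^{d+1}` and every site `x` with level-`j` ancestor `⌊x∕L⌋^{[j]}`,
J-B's composite `compT L (bgT L V) j (⌊x∕L⌋^{[j]}) x` (`B9B8AveragingKernelZd`: top leg first, each leg the axial transporter of `V̄ⁿ` from the base of the `L`-block of the
level-`(n+1)` ancestor) equals p06's `B9Eq358Decomposition.compT L V j (⌊x∕L⌋^{[j]}) x` (the tower gauge function peeled from the top, `compT_succ_top`) — both are print's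
`V(Γ^{(j)}_{y,x}) = V̄^{j−1}(Γ_{Ly,x_{j−1}})⋯V(Γ_{Lx₁,x})` (3.55). [cite: Balaban1985BackgroundPropagators, (3.55) p.401, (3.19) p.393; Balaban1985Averaging, (52)–(53) p.27] -/
theorem compT_bgT_eq_compT358 (L : ℕ) (V : LSite (d + 1) → Fin (d + 1) → 𝔸ˣ) :
    ∀ (j : ℕ) (x : LSite (d + 1)),
      B9B8AveragingKernelZd.compT L (bgT L V) j ((blockMap L)^[j] x) x = B9Eq358Decomposition.compT L V j ((blockMap L)^[j] x) x
  | 0, x => by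
    rw [B9B8AveragingKernelZd.compT_zero]
    show (1 : 𝔸ˣ) = B8Eq115GaugeFixing.tg L (fun l => avgIter L V l) 0 ((blockMap L)^[0] x) 0 x
    rw [B8Eq115GaugeFixing.tg_zero, Function.iterate_zero, id, axialFn_self]
  | j + 1, x => by
    have hfl : (fl L)^[j + 1] x = (blockMap L)^[j + 1] x := rfl
    have hflj : (fl L)^[j] x = (blockMap L)^[j] x := rfl
    rw [B9B8AveragingKernelZd.compT_succ, compT_succ_top L V j ((blockMap L)^[j + 1] x) x hfl, hflj, ← compT_bgT_eq_compT358 L V j x]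
    -- the top legs agree: `bgT L V j y x′ = axialFn (V̄ʲ) (L·y) x′` (`blockBase L y = L • y`)
    have hb : bgT L V j ((blockMap L)^[j + 1] x) ((blockMap L)^[j] x) =
        axialFn (avgIter L V j) ((L : ℤ) • (blockMap L)^[j + 1] x) ((blockMap L)^[j] x) := by
      show axialFn (avgIter L V j) (blockBase L ((blockMap L)^[j + 1] x)) ((blockMap L)^[j] x) = _
      rw [B8Eq119TwistedAxial.blockBase_eq_smul]
    rw [hb]

omit [NormedAlgebra ℂ 𝔸] [CompleteSpace 𝔸] in
/-- `‖c′ − c‖ ≤ ‖c′c⁻¹ − 1‖·‖c‖` for units (`c′ − c = (c′c⁻¹ − 1)·c`). [folklore] [cite: Balaban1985BackgroundPropagators, (3.58) p.402 (from the key estimate of p.401)] -/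
theorem norm_units_sub_le_of_pFac (c' c : 𝔸ˣ) : ‖(c' : 𝔸) - c‖ ≤ ‖(c' : 𝔸) * ((c⁻¹ : 𝔸ˣ) : 𝔸) - 1‖ * ‖(c : 𝔸)‖ := by
  have e : (c' : 𝔸) - c = ((c' : 𝔸) * ((c⁻¹ : 𝔸ˣ) : 𝔸) - 1) * (c : 𝔸) := by
    rw [sub_mul, one_mul, mul_assoc, Units.inv_mul, mul_one]
  rw [e]; exact norm_mul_le _ _

end Bridge

/-! ## §2 Block geometry: a box point of the block `s` carries a torus site of level `j_s`; the block exponent is `α₁L^{−j}`-small -/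

section Block

variable {𝔸 : Type} [NormedRing 𝔸] [NormedAlgebra ℂ 𝔸] [CompleteSpace 𝔸]
variable (i : KIdx d ℓ hd hL b₀ b₁)

omit [NormedRing 𝔸] [NormedAlgebra ℂ 𝔸] [CompleteSpace 𝔸] in
/-- every box point `x` of the block `s = (j, y) ∈ 𝔅` lifts the torus site `0 + x` of level EXACTLY `j` ([4] (2.3)–(2.4): `x ∈ Bʲ(Λ_j)`; this lineage's `blk_eq_of_inBox_block` +
J-B's box chart). [cite: Balaban1984PropagatorsII, (2.3)–(2.4) p.224; Balaban1985BackgroundPropagators, (3.37) p.396 («on Ω_j»)] -/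
theorem lev_eq_of_mem_blockBox (s : BlkY i) {x : LSite (d + 1)}
    (hx : InBox (blockBase ((ℓ + 1) ^ s.1.1) s.1.2) (blockBase ((ℓ + 1) ^ s.1.1) s.1.2 + ((((ℓ + 1 : ℕ) : ℤ) ^ s.1.1) - 1) • (1 : LSite (d + 1))) x) :
    levV1 i (transl (0 : Site (PV d ℓ i.m i.K hd hL) 0) x) = s.1.1 := by
  have hblk : blk ((ℓ + 1) ^ s.1.1) x = s.1.2 := blk_eq_of_inBox_block hx
  have hxXB : x ∈ (toKT i).XB := mem_XB_of_blk_eq i s hblk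
  have hbox : toBox i.hN (transl (0 : Site (PV d ℓ i.m i.K hd hL) 0) x) = ⟨x, hxXB⟩ := by
    rw [← boxEquiv_apply]; exact boxEquiv_transl_of_mem i hxXB
  show i.D.lev (toBox i.hN (transl (0 : Site (PV d ℓ i.m i.K hd hL) 0) x)).1 = s.1.1
  rw [hbox]
  exact lev_eq_of_blkOf_eq i.D.toDomains ((blkOf_eq_iff_blk i.D.toDomains).2 hblk)

/-- ★ **THE BLOCK EXPONENT IS `α₁L^{−j}`-SMALL**: for `a` in r06's nested class (3.37) at `α₁`, the restriction `a♭` of the lifted exponent `a♯(x, κ) = iη·a_κ(0 + x)` to the bonds of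
the block box of `s = (j, y)` satisfies `‖a♭(x, κ)‖ ≤ α₁·(Lʲ)⁻¹` everywhere (inside: level `j` and «|A′| < α₁(Lʲη)⁻¹ on Ω_j»; outside: `0`).
[cite: Balaban1985BackgroundPropagators, (3.37) p.396, p.401 («|A| < α₁(Lʲη)⁻¹ on Bʲ(Λ_j)» p.406)] -/
theorem norm_blockExponentKnit_le (s : BlkY i) {U : CfgY 𝔸 i} {α₁ : ℝ} (hα₁ : 0 ≤ α₁) {a : AfldY 𝔸 i}
    (h37 : Cplx337 (shiftsV1 (PV d ℓ i.m i.K hd hL)) U (kGeo i).eta (kGeo i).L (levV1 i) α₁ a) :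
    ∀ (x : LSite (d + 1)) (κ : Fin (d + 1)),
      ‖insCfg (bondsIn (blockBase ((ℓ + 1) ^ s.1.1) s.1.2) (blockBase ((ℓ + 1) ^ s.1.1) s.1.2 + ((((ℓ + 1 : ℕ) : ℤ) ^ s.1.1) - 1) • (1 : LSite (d + 1))))
          (restr (bondsIn (blockBase ((ℓ + 1) ^ s.1.1) s.1.2) (blockBase ((ℓ + 1) ^ s.1.1) s.1.2 + ((((ℓ + 1 : ℕ) : ℤ) ^ s.1.1) - 1) • (1 : LSite (d + 1))))
            (fun z μ => ((Complex.I * ((kGeo i).eta : ℝ) : ℂ)) • a μ (transl (0 : Site (PV d ℓ i.m i.K hd hL) 0) z))) x κ‖ ≤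
        α₁ * ((((ℓ + 1 : ℕ) : ℝ)) ^ s.1.1)⁻¹ := by
  classical
  intro x κ
  set S := bondsIn (blockBase ((ℓ + 1) ^ s.1.1) s.1.2) (blockBase ((ℓ + 1) ^ s.1.1) s.1.2 + ((((ℓ + 1 : ℕ) : ℤ) ^ s.1.1) - 1) • (1 : LSite (d + 1))) with hS
  have hLj : (0 : ℝ) < (((ℓ + 1 : ℕ) : ℝ)) ^ s.1.1 := by positivity
  have hη : 0 < (kGeo i).eta := geo9K_eta_pos i
  by_cases hmem : (x, κ) ∈ S
  · have hval : insCfg S (restr S (fun z μ => ((Complex.I * ((kGeo i).eta : ℝ) : ℂ)) • a μ (transl (0 : Site (PV d ℓ i.m i.K hd hL) 0) z))) x κ =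
        ((Complex.I * ((kGeo i).eta : ℝ) : ℂ)) • a κ (transl (0 : Site (PV d ℓ i.m i.K hd hL) 0) x) := by
      simp [insCfg, restr, hmem]
    rw [hval, norm_smul, norm_mul, Complex.norm_I, one_mul, Complex.norm_real, Real.norm_of_nonneg hη.le]
    -- the site has level `j`, so the nested class applies at level `j`
    have hlev : levV1 i (transl (0 : Site (PV d ℓ i.m i.K hd hL) 0) x) = s.1.1 := lev_eq_of_mem_blockBox i s (mem_bondsIn.1 hmem).1
    have hOm : OnOmega (levV1 i) s.1.1 (transl (0 : Site (PV d ℓ i.m i.K hd hL) 0) x) := by show s.1.1 ≤ _; rw [hlev]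
    have hb := h37.1 s.1.1 κ _ hOm
    have hsc : scaleLen (kGeo i).L (kGeo i).eta s.1.1 = (((ℓ + 1 : ℕ) : ℝ)) ^ s.1.1 * (kGeo i).eta := rfl
    rw [hsc] at hb
    have hpos : 0 < (((ℓ + 1 : ℕ) : ℝ)) ^ s.1.1 * (kGeo i).eta := by positivity
    have hb' := (lt_mul_inv_iff₀ hpos).1 hb
    rw [le_mul_inv_iff₀ hLj]
    nlinarith [hb', norm_nonneg (a κ (transl (0 : Site (PV d ℓ i.m i.K hd hL) 0) x)), hη]
  · have hval : insCfg S (restr S (fun z μ => ((Complex.I * ((kGeo i).eta : ℝ) : ℂ)) • a μ (transl (0 : Site (PV d ℓ i.m i.K hd hL) 0) z))) x κ = 0 := by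
      simp [insCfg, hmem]
    rw [hval, norm_zero]; positivity

end Block

/-! ## §3 (3.58) at the knit transporter on (3.35) × (3.37) -/

section Main

open scoped Matrix Matrix.Norms.L2Operator

variable {N : ℕ} [Nonempty (Fin N)] (i : KIdx d ℓ hd hL b₀ b₁) {G : Subgroup (Matrix (Fin N) (Fin N) ℂ)ˣ}

/-- ★★ **THE BLOCK-LEVEL ESTIMATE**: for a member background `U` of `(bg9KP M_N(ℂ) G i).Reg335 c₀ α₀` (`G ≤ U(N)`, `c₀ ≤ 10`, `0 ≤ Mα₀`, `K_pl(Mα₀)L⁴ < α₀′`, [5] Prop. 2's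
numerics), a perturbation exponent `B` on `ℤ^{d+1}` with `sup‖B‖ ≤ b`, and a box site `w` of block `s = (j, y)`: the J-B composites at the RETRACTION `Û_s` of `U♯` to the block box and
at `e^{B}Û_s` differ by `≤ 154(d+1)·(Lʲb)` whenever `Lʲb` lies in p06's window (`e^{…α₀′}(1 + 8C₁Lʲb) ≤ 2`, `2Lʲb ≤ c₃`, `4096(d+1)Lʲb ≤ 1`) — p06's key estimate through the bridge,
`U′U(Γ) − U(Γ) = (P − 1)U(Γ)`, `U(Γ)` unitary. [cite: Balaban1985BackgroundPropagators, (3.55)–(3.58) pp.401–402, (3.35) p.396; Balaban1985Averaging, Prop. 2 p.26, Prop. 6 (164) p.43] -/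
theorem norm_compT_retract_expCfg_sub_le (hG1 : ∀ u : (Matrix (Fin N) (Fin N) ℂ)ˣ, u ∈ G → ‖(u : Matrix (Fin N) (Fin N) ℂ)‖ ≤ 1)
    (hGU : G ≤ unitaryUnits (Matrix (Fin N) (Fin N) ℂ))
    (U : CfgY (Matrix (Fin N) (Fin N) ℂ) i) {c₀ α₀ : ℝ} (hc : c₀ ≤ 10) (hMα : 0 ≤ (kGeo i).M * α₀)
    (hreg : (bg9KP (Matrix (Fin N) (Fin N) ℂ) G i).Reg335 c₀ α₀ U) {α₀' : ℝ} (hα' : 0 < α₀') (hα3 : C0 (d + 1) * α₀' ≤ 1 / 3)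
    (hα4 : 4 * α₀' ≤ c2' (d + 1) (ℓ + 1)) (hK : Kpl i ((kGeo i).M * α₀) * (kGeo i).L ^ 4 < α₀') (s : BlkY i)
    (B : LSite (d + 1) → Fin (d + 1) → Matrix (Fin N) (Fin N) ℂ) {b : ℝ} (hb : 0 ≤ b) (hB : ∀ x κ, ‖B x κ‖ ≤ b)
    (hsmall : Real.exp (4 * (800 * (((d + 1 : ℕ) : ℝ) + 1) ^ 2 * (((d + 1 : ℕ) : ℝ) + 4)) * α₀')
      * (1 + 8 * (131072 * (((d + 1 : ℕ) : ℝ) + 1) ^ 2) * ((((ℓ + 1 : ℕ) : ℝ)) ^ s.1.1 * b)) ≤ 2)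
    (hc₃ : 2 * ((((ℓ + 1 : ℕ) : ℝ)) ^ s.1.1 * b) ≤ c3 (d + 1) (ℓ + 1)) (hsm : 4096 * ((d + 1 : ℕ) : ℝ) * ((((ℓ + 1 : ℕ) : ℝ)) ^ s.1.1 * b) ≤ 1)
    {w : SiteY i} (hw : blkOf i.D.toDomains w = s) :
    ‖((B9B8AveragingKernelZd.compT (ℓ + 1) (bgT (ℓ + 1)
          (expCfg B * retrCfg (blockBase ((ℓ + 1) ^ s.1.1) s.1.2) (blockBase ((ℓ + 1) ^ s.1.1) s.1.2 + ((((ℓ + 1 : ℕ) : ℤ) ^ s.1.1) - 1) • (1 : LSite (d + 1)))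
            (liftCfg U))) s.1.1 s.1.2 w.1 : (Matrix (Fin N) (Fin N) ℂ)ˣ) : Matrix (Fin N) (Fin N) ℂ) -
        B9B8AveragingKernelZd.compT (ℓ + 1) (bgT (ℓ + 1)
          (retrCfg (blockBase ((ℓ + 1) ^ s.1.1) s.1.2) (blockBase ((ℓ + 1) ^ s.1.1) s.1.2 + ((((ℓ + 1 : ℕ) : ℤ) ^ s.1.1) - 1) • (1 : LSite (d + 1)))
            (liftCfg U))) s.1.1 s.1.2 w.1‖ ≤ 154 * ((d + 1 : ℕ) : ℝ) * ((((ℓ + 1 : ℕ) : ℝ)) ^ s.1.1 * b) := by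
  letI : CStarAlgebra (Matrix (Fin N) (Fin N) ℂ) := {}
  have hL2 : 2 ≤ ℓ + 1 := hL.2
  have hα2 : 2 * α₀' ≤ c2' (d + 1) (ℓ + 1) := by linarith
  set j : ℕ := s.1.1 with hj
  set y : LSite (d + 1) := s.1.2 with hy
  set V := retrCfg (blockBase ((ℓ + 1) ^ j) y) (blockBase ((ℓ + 1) ^ j) y + ((((ℓ + 1 : ℕ) : ℤ) ^ j) - 1) • (1 : LSite (d + 1))) (liftCfg U) with hV
  have hU : ∀ μ x, U μ x ∈ unitaryUnits (Matrix (Fin N) (Fin N) ℂ) := fun μ x => hGU (mem_of_reg335P (G := G) i hreg μ x)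
  have hVu : ∀ x μ, V x μ ∈ unitaryUnits (Matrix (Fin N) (Fin N) ℂ) := fun x μ => retrCfg_mem (fun x μ => liftCfg_mem hU x μ) x μ
  have h52 : pdev V < α₀' * ((((ℓ + 1 : ℕ) : ℝ) ^ j)⁻¹) ^ 2 := pdev_retract_block_lt i hG1 U hc hMα hreg hK s
  -- `w` has level `j` and label `y`
  have hit : (blockMap (ℓ + 1))^[j] w.1 = y := by
    rw [blockMap_iterate, ← blk_eq_blockMap]; exact (blkOf_eq_iff_blk i.D.toDomains).1 hw
  -- through the bridge to p06's composites
  have e1 := compT_bgT_eq_compT358 (ℓ + 1) (expCfg B * V) j w.1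
  have e0 := compT_bgT_eq_compT358 (ℓ + 1) V j w.1
  rw [hit] at e1 e0
  rw [e1, e0]
  -- the key estimate at the retraction and `U′U(Γ) − U(Γ) = (P − 1)·U(Γ)`
  have hP := norm_pFac_sub_one_le_linear (L := ℓ + 1) (G := unitaryUnits (Matrix (Fin N) (Fin N) ℂ)) (j := j) (U := V) (B := B) hL2
    (avgClosed_unitaryUnits (d + 1) (ℓ + 1)) hVu hα' hα3 hα4 h52 hb hB hsmall hc₃ hsm y (x := w.1) hit
  have havg := avgIter_mem (ℓ + 1) hL2 (avgClosed_unitaryUnits (d + 1) (ℓ + 1)) j V hVu hα' hα3 hα2 h52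
  have hUl : ∀ l ≤ j, ∀ x κ, avgIter (ℓ + 1) V l x κ ∈ U1 (Matrix (Fin N) (Fin N) ℂ) := fun l hl x κ => unitaryUnits_le_U1 (havg l hl x κ)
  have hc1 : ‖((B9Eq358Decomposition.compT (ℓ + 1) V j y w.1 : (Matrix (Fin N) (Fin N) ℂ)ˣ) : Matrix (Fin N) (Fin N) ℂ)‖ ≤ 1 :=
    (B7Prop1Explicit.mem_U1.1 (compT_mem (ℓ + 1) hUl y w.1)).1
  refine (norm_units_sub_le_of_pFac _ _).trans ?_
  have hP' : ‖((B9Eq358Decomposition.compT (ℓ + 1) (expCfg B * V) j y w.1 : (Matrix (Fin N) (Fin N) ℂ)ˣ) : Matrix (Fin N) (Fin N) ℂ) *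
        (((B9Eq358Decomposition.compT (ℓ + 1) V j y w.1)⁻¹ : (Matrix (Fin N) (Fin N) ℂ)ˣ) : Matrix (Fin N) (Fin N) ℂ) - 1‖ ≤
      154 * ((d + 1 : ℕ) : ℝ) * ((((ℓ + 1 : ℕ) : ℝ)) ^ j * b) := by
    have e : ((B9Eq358Decomposition.compT (ℓ + 1) (expCfg B * V) j y w.1 : (Matrix (Fin N) (Fin N) ℂ)ˣ) : Matrix (Fin N) (Fin N) ℂ) *
        (((B9Eq358Decomposition.compT (ℓ + 1) V j y w.1)⁻¹ : (Matrix (Fin N) (Fin N) ℂ)ˣ) : Matrix (Fin N) (Fin N) ℂ) =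
        ((pFac (ℓ + 1) V (expCfg B) j y w.1 : (Matrix (Fin N) (Fin N) ℂ)ˣ) : Matrix (Fin N) (Fin N) ℂ) := by
      rw [pFac, Units.val_mul]
    rw [e]; exact_mod_cast hP
  have h0 : 0 ≤ 154 * ((d + 1 : ℕ) : ℝ) * ((((ℓ + 1 : ℕ) : ℝ)) ^ j * b) := by positivity
  calc _ ≤ 154 * ((d + 1 : ℕ) : ℝ) * ((((ℓ + 1 : ℕ) : ℝ)) ^ j * b) * 1 := mul_le_mul hP' hc1 (norm_nonneg _) h0
    _ = _ := mul_one _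

/-- ★★★ **(3.58) AT THE KNIT SITE TRANSPORTER ON (3.35) × (3.37), CORNER PAIRS** — in dag-n06-c's displayed law shape `ParVar337Y G i (parKnitY i) (Reg335 c₀) (154(d+1)) αK aK`:
for every `0 < α₀` with `M·α₀ ≤ aK` and every `U` in `(bg9KP M_N(ℂ) G i).Reg335 c₀ α₀` (`G ≤ U(N)`), every `0 < α₁ ≤ αK` and `a` in the nested class (3.37) `Cplx337 … α₁ a`, every block
`s` and site `w` of `s`: `‖U′U(Γ^{(j_s)}_{y_s,w}) − U(Γ^{(j_s)}_{y_s,w})‖ ≤ 154(d+1)·α₁` for `U′U = e^{iηa}·U` — locality (`compT_bgT_congr`) puts both transporters at the retraction to the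
block, the lift of the product is `e^{a♯}U♯` (`liftCfg_mulY_fluct`) with `a♯ ↦ a♭` of size `α₁L^{−j}` (§2), and the block-level estimate applies with `Lʲb = α₁`.
[cite: Balaban1985BackgroundPropagators, (3.58) p.402, (3.55)–(3.57) p.401, (3.35)–(3.37) p.396; Balaban1985Averaging, Proposition 6 (164) p.43, Prop. 2 p.26] -/
theorem norm_parKnitY_mulY_sub_le (hGU : G ≤ unitaryUnits (Matrix (Fin N) (Fin N) ℂ)) {c₀ : ℝ} (hc : c₀ ≤ 10)
    {α₀' : ℝ} (hα' : 0 < α₀') (hα3 : C0 (d + 1) * α₀' ≤ 1 / 3) (hα4 : 4 * α₀' ≤ c2' (d + 1) (ℓ + 1))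
    {aK αK : ℝ} (hKpl : ∀ a : ℝ, 0 ≤ a → a ≤ aK → Kpl i a * (kGeo i).L ^ 4 < α₀')
    (hsmall : Real.exp (4 * (800 * (((d + 1 : ℕ) : ℝ) + 1) ^ 2 * (((d + 1 : ℕ) : ℝ) + 4)) * α₀')
      * (1 + 8 * (131072 * (((d + 1 : ℕ) : ℝ) + 1) ^ 2) * αK) ≤ 2)
    (hc₃ : 2 * αK ≤ c3 (d + 1) (ℓ + 1)) (hsm : 4096 * ((d + 1 : ℕ) : ℝ) * αK ≤ 1) :
    ∀ (α₀ : ℝ) (U : CfgY (Matrix (Fin N) (Fin N) ℂ) i), 0 < α₀ → (kGeo i).M * α₀ ≤ aK →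
      (bg9KP (Matrix (Fin N) (Fin N) ℂ) G i).Reg335 c₀ α₀ U → GVal G i U →
      ∀ (α₁ : ℝ) (a : AfldY (Matrix (Fin N) (Fin N) ℂ) i), 0 < α₁ → α₁ ≤ αK →
        Cplx337 (shiftsV1 (PV d ℓ i.m i.K hd hL)) U (kGeo i).eta (kGeo i).L (levV1 i) α₁ a →
        ∀ (s : BlkY i) (w : SiteY i), blkOf i.D.toDomains w = s →
          ‖((parKnitY i (mulY i (fluct (kGeo i).eta a) U) (blkCornerY i s) w : (Matrix (Fin N) (Fin N) ℂ)ˣ) : Matrix (Fin N) (Fin N) ℂ) -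
              parKnitY i U (blkCornerY i s) w‖ ≤ 154 * ((d : ℝ) + 1) * α₁ := by
  intro α₀ U hα₀ hMa hreg _hUG α₁ a hα₁ hα₁K h37 s w hw
  letI : CStarAlgebra (Matrix (Fin N) (Fin N) ℂ) := {}
  have hL1 : 1 ≤ ℓ + 1 := Nat.succ_pos ℓ
  have hG1 : ∀ u : (Matrix (Fin N) (Fin N) ℂ)ˣ, u ∈ G → ‖(u : Matrix (Fin N) (Fin N) ℂ)‖ ≤ 1 :=
    fun u hu => (B7Prop1Explicit.mem_U1.1 (unitaryUnits_le_U1 (hGU hu))).1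
  have hMx : 0 ≤ (kGeo i).M := by show (0 : ℝ) ≤ ((ℓ + 1 : ℕ) : ℝ) * (i.Mh : ℝ); positivity
  have hMα : 0 ≤ (kGeo i).M * α₀ := mul_nonneg hMx hα₀.le
  have hK : Kpl i ((kGeo i).M * α₀) * (kGeo i).L ^ 4 < α₀' := hKpl _ hMα hMa
  set Lj : ℝ := (((ℓ + 1 : ℕ) : ℝ)) ^ s.1.1 with hLj
  have hLj0 : 0 < Lj := by positivity
  set lo : LSite (d + 1) := blockBase ((ℓ + 1) ^ s.1.1) s.1.2 with hlo
  set hi : LSite (d + 1) := blockBase ((ℓ + 1) ^ s.1.1) s.1.2 + ((((ℓ + 1 : ℕ) : ℤ) ^ s.1.1) - 1) • (1 : LSite (d + 1)) with hhi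
  set V := retrCfg lo hi (liftCfg U) with hV
  set Ash : LSite (d + 1) → Fin (d + 1) → Matrix (Fin N) (Fin N) ℂ :=
    fun z μ => ((Complex.I * ((kGeo i).eta : ℝ) : ℂ)) • a μ (transl (0 : Site (PV d ℓ i.m i.K hd hL) 0) z) with hAsh
  set Afl := insCfg (bondsIn lo hi) (restr (bondsIn lo hi) Ash) with hAfl
  -- the label of `w`
  have hit : (blockMap (ℓ + 1))^[s.1.1] w.1 = s.1.2 := by
    rw [blockMap_iterate, ← blk_eq_blockMap]; exact (blkOf_eq_iff_blk i.D.toDomains).1 hw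
  -- locality: both transporters at the retraction
  have hag0 : AgreeOn lo hi (liftCfg U) V := fun x μ hx hxe => (retrCfg_eq_of_bondIn (liftCfg U) ⟨hx, hxe⟩).symm
  have hag1 : AgreeOn lo hi (liftCfg (P := PV d ℓ i.m i.K hd hL) (mulY i (fluct (kGeo i).eta a) U)) (expCfg Afl * V) := by
    have e : liftCfg (P := PV d ℓ i.m i.K hd hL) (mulY i (fluct (kGeo i).eta a) U) = expCfg Ash * liftCfg U := liftCfg_mulY_fluct i (kGeo i).eta a U
    rw [e]
    intro x κ hx hxe
    rw [Pi.mul_apply, Pi.mul_apply, Pi.mul_apply, Pi.mul_apply, agreeOn_expCfg (agreeOn_insCfg_restr _ _ Ash) x κ hx hxe, hag0 x κ hx hxe]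
  have e0 : parKnitY i U (blkCornerY i s) w = B9B8AveragingKernelZd.compT (ℓ + 1) (bgT (ℓ + 1) V) s.1.1 s.1.2 w.1 := by
    show B9B8AveragingJunction.parOfT i (bgT (ℓ + 1) (liftCfg U)) (blkCornerY i s) w = _
    rw [parOfT_blkCornerY i _ hw, ← hit]
    exact compT_bgT_congr hL1 s.1.1 w.1 (by rw [hit]; exact hag0)
  have e1 : parKnitY i (mulY i (fluct (kGeo i).eta a) U) (blkCornerY i s) w =
      B9B8AveragingKernelZd.compT (ℓ + 1) (bgT (ℓ + 1) (expCfg Afl * V)) s.1.1 s.1.2 w.1 := by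
    show B9B8AveragingJunction.parOfT i (bgT (ℓ + 1) (liftCfg (P := PV d ℓ i.m i.K hd hL) (mulY i (fluct (kGeo i).eta a) U))) (blkCornerY i s) w = _
    rw [parOfT_blkCornerY i _ hw, ← hit]
    exact compT_bgT_congr hL1 s.1.1 w.1 (by rw [hit]; exact hag1)
  rw [e1, e0]
  -- the block exponent has size `b := α₁L^{−j}`, `Lʲb = α₁`
  have hb0 : 0 ≤ α₁ * Lj⁻¹ := by positivity
  have hAfl : ∀ x κ, ‖Afl x κ‖ ≤ α₁ * Lj⁻¹ := norm_blockExponentKnit_le i s hα₁.le h37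
  have eLb : Lj * (α₁ * Lj⁻¹) = α₁ := by rw [mul_comm α₁, ← mul_assoc, mul_inv_cancel₀ hLj0.ne', one_mul]
  have hsmall' : Real.exp (4 * (800 * (((d + 1 : ℕ) : ℝ) + 1) ^ 2 * (((d + 1 : ℕ) : ℝ) + 4)) * α₀')
      * (1 + 8 * (131072 * (((d + 1 : ℕ) : ℝ) + 1) ^ 2) * (Lj * (α₁ * Lj⁻¹))) ≤ 2 := by
    rw [eLb]
    refine le_trans (mul_le_mul_of_nonneg_left ?_ (Real.exp_pos _).le) hsmall
    nlinarith
  have hc₃' : 2 * (Lj * (α₁ * Lj⁻¹)) ≤ c3 (d + 1) (ℓ + 1) := by rw [eLb]; linarith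
  have hsm' : 4096 * ((d + 1 : ℕ) : ℝ) * (Lj * (α₁ * Lj⁻¹)) ≤ 1 := by
    rw [eLb]; exact le_trans (by nlinarith [Nat.cast_nonneg (α := ℝ) (d + 1)]) hsm
  have h := norm_compT_retract_expCfg_sub_le i hG1 hGU U hc hMα hreg hα' hα3 hα4 hK s Afl hb0 hAfl hsmall' hc₃' hsm' hw
  rw [eLb] at h
  refine h.trans (le_of_eq ?_)
  push_cast; ring

/-- ★★★ **dag-n06-c's DISPLAYED LAW `ParVar337Y` INHABITED AT THE KNIT TRANSPORTER** with `R := (bg9KP M_N(ℂ) G i).Reg335 c₀`, `C_p := 154(d+1)` — the (K1) input of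
`B9SectBCodedClassKnitY.hclass_C37KY_on` (the coded → record transfer of the knit class). [cite: Balaban1985BackgroundPropagators, (3.58) p.402, p.401, (3.35)–(3.37) p.396] -/
theorem parVar337Y_parKnitY (hGU : G ≤ unitaryUnits (Matrix (Fin N) (Fin N) ℂ)) {c₀ : ℝ} (hc : c₀ ≤ 10)
    {α₀' : ℝ} (hα' : 0 < α₀') (hα3 : C0 (d + 1) * α₀' ≤ 1 / 3) (hα4 : 4 * α₀' ≤ c2' (d + 1) (ℓ + 1))
    {aK αK : ℝ} (hKpl : ∀ a : ℝ, 0 ≤ a → a ≤ aK → Kpl i a * (kGeo i).L ^ 4 < α₀')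
    (hsmall : Real.exp (4 * (800 * (((d + 1 : ℕ) : ℝ) + 1) ^ 2 * (((d + 1 : ℕ) : ℝ) + 4)) * α₀')
      * (1 + 8 * (131072 * (((d + 1 : ℕ) : ℝ) + 1) ^ 2) * αK) ≤ 2)
    (hc₃ : 2 * αK ≤ c3 (d + 1) (ℓ + 1)) (hsm : 4096 * ((d + 1 : ℕ) : ℝ) * αK ≤ 1) :
    ParVar337Y G i (parKnitY i) (fun α₀ U => (bg9KP (Matrix (Fin N) (Fin N) ℂ) G i).Reg335 c₀ α₀ U) (154 * ((d : ℝ) + 1)) αK aK :=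
  fun α₀ U hα₀ hMa hreg hUG α₁ a hα₁ hα₁K h37 w =>
    norm_parKnitY_mulY_sub_le i hGU hc hα' hα3 hα4 hKpl hsmall hc₃ hsm α₀ U hα₀ hMa hreg hUG α₁ a hα₁ hα₁K h37 (blkY i w) w rfl

end Main

end Literature.MathematicalPhysics.QuantumFieldTheory.Balaban1983to89.B9Eq358KnitTransporterVariationY

end
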